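import Literature.NumberTheory.Transcendental.BakerLinearFormPi
import Literature.NumberTheory.Transcendental.GammaMonomialsProofs
import Literature.NumberTheory.Automorphic.ZhouLegendreGreenValuesProofs
import HarnessLib

/-!
# Murty–Saradha 2010: the Euler–Lehmer engines and the distinctness of `γ, qγ(a,q)` (Theorem 4)

Topic `Literature/NumberTheory/Transcendental`. Proofs only (no definitions, no named facts).

M. Ram Murty and N. Saradha, *Euler–Lehmer constants and a conjecture of Erdős*, J. Number Theory
130 (2010) 2671–2682 [MurtySaradha2010]. With Lehmer's constants
`γ(a,q) = lim_{x→∞} (Σ_{n ≤ x, n ≡ a (q)} 1/n − (log x)/q)` and `γ(a,q) = −(ψ(a/q) + log q)/q`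
(proof of Lemma 8; the tree's `EulerLehmer.tendsto_sum_inv_sub_log_div`, P1 g56):

* «**Theorem 4.** All of the numbers in the listing `γ, γ*(a,q), 1 ≤ a < q, q ≥ 2, (a,q) ≠ (2,4)`
  are distinct» (`γ*(a,q) = qγ(a,q)`) — `eulerLehmerStar_injective`,
  `eulerLehmerStar_eq_eulerMascheroni_iff`, in the sharper «algebraic difference» forms
  `eq_of_isAlgebraic_eulerLehmerStar_sub`, `eq_two_four_of_isAlgebraic_digamma_add` from which
  Theorem 1 («at most one `γ(a,q)` is algebraic») and Corollary 2 follow in the sequel file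
  `EulerLehmerConstantsAtMostOneAlgebraic.lean`.

The printed proofs (§3, §5) run through Gauss's formula (7) and Lemma 10 (`c₀π + Σ cᵢ log αᵢ` is
transcendental for `c₀ ≠ 0`; tree: `baker_pi_coeff_eq_zero`, `BakerLinearFormPi.lean`): an
algebraic `q₁γ(a₁,q₁) − q₂γ(a₂,q₂)` kills the `π`-coefficient `½(cot(πa₁/q₁) − cot(πa₂/q₂))`, so
`a₁/q₁ = a₂/q₂` by the monotonicity of the cotangent, and the remaining `log` is handled by
Lindemann. HERE the same, with two simplifications the tree affords: Gauss's digamma theorem is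
the tree's `LegendreP.digammaReal_rat_log_sin` (Andrews–Askey–Roy (1.2.16), valid for EVERY
`1 ≤ p < q`, so the reduction (1) to `gcd(a,q) = 1` is not needed), and the COEFFICIENT form of
Lemma 10 returns, besides the vanishing `π`-coefficient, the vanishing of the whole form, so that
`log q₁ = log q₂` directly. The ENGINES `two_mul_eq_of_isAlgebraic` (one point: `2a = q`) and
`div_eq_div_of_isAlgebraic` (two points: `a/q = b/r`) are stated over the tree's real digamma
`digammaReal`; the theorems over Mathlib's `Complex.digamma` at `a/q`.

Cell pub-zeta5 (HONEST FRAMING: systematic search; no irrationality claim unless certified): a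
printed 2010 theorem made a kernel theorem on the tree's proved Baker theorem; nothing here
concerns `ζ(5)` or the arithmetic nature of `γ` itself.
-/

noncomputable section

open Complex Finset
open Literature.NumberTheory.Automorphic (digammaReal)
open Literature.NumberTheory.Automorphic.LegendreP (digammaReal_rat_log_sin
  digamma_ofReal_eq_digammaReal)
open Literature.NumberTheory.Transcendental.KoblitzOgus (isAlgebraic_cos_rat_mul_pi
  isAlgebraic_sin_rat_mul_pi isAlgebraic_I)

namespace Literature.NumberTheory.Transcendental

namespace MurtySaradha2010

/-! ### Lemma 10 over `ℝ`, coefficient form -/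

/-- **Lemma 10, real coefficient form**: if `y = kπ + Σᵢ cᵢ log αᵢ` with `y, k, cᵢ` real algebraic
and `αᵢ > 0` real algebraic, then `y = 0` and `k = 0`. [cite: MurtySaradha2010, Lemma 10] -/
theorem eq_zero_of_eq_pi_mul_add_sum_log {ι : Type*} [Fintype ι] (α : ι → ℝ) (hα : ∀ i, 0 < α i)
    (hαalg : ∀ i, IsAlgebraic ℚ (α i)) {y k : ℝ} {c : ι → ℝ} (hy : IsAlgebraic ℚ y)
    (hk : IsAlgebraic ℚ k) (hc : ∀ i, IsAlgebraic ℚ (c i))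
    (h : y = k * Real.pi + ∑ i, c i * Real.log (α i)) : y = 0 ∧ k = 0 := by
  have hC : (y : ℂ) = (k : ℂ) * (Real.pi : ℂ) + ∑ i, (c i : ℂ) * ((Real.log (α i) : ℝ) : ℂ) := by
    exact_mod_cast h
  have hrel : -(y : ℂ) + (-I * k) * ((Real.pi : ℂ) * I) +
      ∑ i, (c i : ℂ) * ((Real.log (α i) : ℝ) : ℂ) = 0 := by
    rw [hC, show -I * (k : ℂ) * ((Real.pi : ℂ) * I) = -(I * I) * (k * Real.pi) by ring, I_mul_I]
    ring
  have hyC : IsAlgebraic ℚ (-(y : ℂ)) := hy.algebraMap.neg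
  have hkC : IsAlgebraic ℚ (-I * (k : ℂ)) := isAlgebraic_I.neg.mul hk.algebraMap
  have hcC : ∀ i, IsAlgebraic ℚ ((c i : ℝ) : ℂ) := fun i => (hc i).algebraMap
  have hB := baker_pi_coeff_eq_zero α hα hαalg hyC hkC hcC hrel
  refine ⟨by exact_mod_cast neg_eq_zero.1 hB.1, ?_⟩
  have := hB.2
  simpa [I_ne_zero] using this

/-! ### Gauss's formula at one rational point, and the trigonometry of the `π`-coefficient -/

/-- Gauss's digamma theorem (7), rearranged: for `1 ≤ a < q`,
`ψ(a/q) + γ + log q = −(π/2)·cot(πa/q) + Σ_{n=1}^{q−1} cos(2πna/q) log(2 sin(πn/q))`.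
[cite: MurtySaradha2010, (6)–(7)] -/
theorem digammaReal_add_eulerMascheroni_add_log {a q : ℕ} (ha : 1 ≤ a) (haq : a < q) :
    digammaReal (a / q) + Real.eulerMascheroniConstant + Real.log q =
      -(1 / 2) * (Real.cos (Real.pi * a / q) / Real.sin (Real.pi * a / q)) * Real.pi +
        ∑ n ∈ Ico 1 q, Real.cos (2 * Real.pi * n * a / q) * Real.log (2 * Real.sin (Real.pi * n / q)) := by
  rw [digammaReal_rat_log_sin ha haq]
  ring

/-- `0 < πn/q < π` for `1 ≤ n < q`. [folklore] -/
private theorem angle_mem {n q : ℕ} (hn : 1 ≤ n) (hnq : n < q) :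
    0 < Real.pi * n / q ∧ Real.pi * n / q < Real.pi := by
  have hq : (0 : ℝ) < q := by exact_mod_cast (show 0 < q by omega)
  refine ⟨by positivity, ?_⟩
  rw [div_lt_iff₀ hq]
  have : (n : ℝ) < q := by exact_mod_cast hnq
  nlinarith [Real.pi_pos]

/-- `2 sin(πn/q) > 0` for `1 ≤ n < q`. [folklore] -/
private theorem two_mul_sin_pos {n q : ℕ} (hn : 1 ≤ n) (hnq : n < q) :
    0 < 2 * Real.sin (Real.pi * n / q) := by
  have h := angle_mem hn hnq
  have := Real.sin_pos_of_pos_of_lt_pi h.1 h.2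
  linarith

/-- `cos(2πna/q)` is algebraic. [folklore] -/
private theorem isAlgebraic_cos_two {n a q : ℕ} (hq : 0 < q) :
    IsAlgebraic ℚ (Real.cos (2 * Real.pi * n * a / q)) := by
  have h := isAlgebraic_cos_rat_mul_pi (2 * n * a) hq
  have e : Real.pi * ((2 * n * a : ℕ) : ℝ) / q = 2 * Real.pi * n * a / q := by push_cast; ring
  rwa [e] at h

/-- Quotients of algebraic reals are algebraic. [folklore] -/
private theorem isAlgebraic_div {x y : ℝ} (hx : IsAlgebraic ℚ x) (hy : IsAlgebraic ℚ y) :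
    IsAlgebraic ℚ (x / y) := by
  rw [div_eq_mul_inv]
  exact hx.mul hy.inv

/-- A vanishing cotangent in `(0, π)`: `cos(πa/q) / sin(πa/q) = 0` with `1 ≤ a < q` forces
`2a = q`. [folklore] -/
private theorem two_mul_eq_of_cot_eq_zero {a q : ℕ} (ha : 1 ≤ a) (haq : a < q)
    (h : Real.cos (Real.pi * a / q) / Real.sin (Real.pi * a / q) = 0) : 2 * a = q := by
  have hθ := angle_mem ha haq
  have hsin := Real.sin_pos_of_pos_of_lt_pi hθ.1 hθ.2
  have hcos : Real.cos (Real.pi * a / q) = 0 := by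
    rcases div_eq_zero_iff.1 h with h | h
    · exact h
    · exact absurd h hsin.ne'
  have h0 : Real.sin (Real.pi * a / q - Real.pi / 2) = 0 := by rw [Real.sin_sub_pi_div_two, hcos, neg_zero]
  have h1 : Real.pi * a / q - Real.pi / 2 = 0 :=
    (Real.sin_eq_zero_iff_of_lt_of_lt (by linarith [Real.pi_pos]) (by linarith [Real.pi_pos])).1 h0
  have hq : (q : ℝ) ≠ 0 := by exact_mod_cast (show q ≠ 0 by omega)
  have h2 : (2 * a : ℝ) = q := by
    field_simp at h1
    linarith [Real.pi_pos, mul_left_cancel₀ Real.pi_ne_zero (show Real.pi * (2 * a) = Real.pi * q by linarith)]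
  exact_mod_cast h2

/-- Equal cotangents in `(0, π)`: `cot(πa/q) = cot(πb/r)` with `1 ≤ a < q`, `1 ≤ b < r` forces
`a/q = b/r` («by the monotonicity of the cotangent function»). [cite: MurtySaradha2010, §3] -/
private theorem div_eq_div_of_cot_eq {a q b r : ℕ} (ha : 1 ≤ a) (haq : a < q) (hb : 1 ≤ b)
    (hbr : b < r)
    (h : Real.cos (Real.pi * a / q) / Real.sin (Real.pi * a / q) =
      Real.cos (Real.pi * b / r) / Real.sin (Real.pi * b / r)) : (a : ℝ) / q = b / r := by
  have h₁ := angle_mem ha haq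
  have h₂ := angle_mem hb hbr
  have hs₁ := Real.sin_pos_of_pos_of_lt_pi h₁.1 h₁.2
  have hs₂ := Real.sin_pos_of_pos_of_lt_pi h₂.1 h₂.2
  rw [div_eq_div_iff hs₁.ne' hs₂.ne'] at h
  have h0 : Real.sin (Real.pi * b / r - Real.pi * a / q) = 0 := by
    rw [Real.sin_sub]; linarith
  have h1 : Real.pi * b / r - Real.pi * a / q = 0 :=
    (Real.sin_eq_zero_iff_of_lt_of_lt (by linarith) (by linarith)).1 h0
  have hq : (q : ℝ) ≠ 0 := by exact_mod_cast (show q ≠ 0 by omega)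
  have hr : (r : ℝ) ≠ 0 := by exact_mod_cast (show r ≠ 0 by omega)
  rw [div_eq_div_iff hq hr]
  have h2 : Real.pi * (b * q) = Real.pi * (a * r) := by
    field_simp at h1
    linarith
  have := mul_left_cancel₀ Real.pi_ne_zero h2
  linarith

/-! ### The engines: one rational point, two rational points -/

/-- **Engine at one point.** For `1 ≤ a < q` and a real algebraic `u`: if
`ψ(a/q) + γ + u·log q` is algebraic then `2a = q` and the number vanishes (Gauss (7) exhibits it as
`−½cot(πa/q)·π + (u−1) log q + Σ_n cos(2πna/q) log(2 sin(πn/q))`, and Lemma 10 in coefficient form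
kills both the `π`-coefficient and the value). [cite: MurtySaradha2010, §3 (proof of Theorem 1, first case)] -/
theorem two_mul_eq_of_isAlgebraic {a q : ℕ} (ha : 1 ≤ a) (haq : a < q) {u : ℝ}
    (hu : IsAlgebraic ℚ u)
    (hy : IsAlgebraic ℚ (digammaReal (a / q) + Real.eulerMascheroniConstant + u * Real.log q)) :
    2 * a = q ∧ digammaReal (a / q) + Real.eulerMascheroniConstant + u * Real.log q = 0 := by
  have hq : 0 < q := by omega
  have hqR : (0 : ℝ) < q := by exact_mod_cast hq
  -- the family of positive algebraic numbers `q, 2 sin(πn/q)` with coefficients `u − 1, cos(2πna/q)`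
  let α : Option (Ico 1 q) → ℝ := fun o => o.elim (q : ℝ) fun n => 2 * Real.sin (Real.pi * n / q)
  let c : Option (Ico 1 q) → ℝ := fun o => o.elim (u - 1) fun n => Real.cos (2 * Real.pi * n * a / q)
  have hα : ∀ o, 0 < α o := by
    rintro (_ | ⟨n, hn⟩)
    · exact hqR
    · exact two_mul_sin_pos (mem_Ico.1 hn).1 (mem_Ico.1 hn).2
  have hαalg : ∀ o, IsAlgebraic ℚ (α o) := by
    rintro (_ | ⟨n, hn⟩)
    · exact isAlgebraic_nat q
    · exact (isAlgebraic_nat 2).mul (isAlgebraic_sin_rat_mul_pi n hq)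
  have hcalg : ∀ o, IsAlgebraic ℚ (c o) := by
    rintro (_ | ⟨n, hn⟩)
    · exact hu.sub isAlgebraic_one
    · exact isAlgebraic_cos_two hq
  have hk : IsAlgebraic ℚ (-(1 / 2) * (Real.cos (Real.pi * a / q) / Real.sin (Real.pi * a / q))) :=
    (isAlgebraic_div isAlgebraic_one (isAlgebraic_nat 2)).neg.mul
      (isAlgebraic_div (isAlgebraic_cos_rat_mul_pi a hq) (isAlgebraic_sin_rat_mul_pi a hq))
  have hid : digammaReal (a / q) + Real.eulerMascheroniConstant + u * Real.log q =
      -(1 / 2) * (Real.cos (Real.pi * a / q) / Real.sin (Real.pi * a / q)) * Real.pi +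
        ∑ o, c o * Real.log (α o) := by
    rw [Fintype.sum_option]
    change _ = _ + ((u - 1) * Real.log q +
      ∑ x : (Ico 1 q), Real.cos (2 * Real.pi * (x : ℕ) * a / q) * Real.log (2 * Real.sin (Real.pi * (x : ℕ) / q)))
    rw [Finset.sum_coe_sort (Ico 1 q)
      (fun n => Real.cos (2 * Real.pi * n * a / q) * Real.log (2 * Real.sin (Real.pi * n / q)))]
    have hG := digammaReal_add_eulerMascheroni_add_log ha haq
    linear_combination hG
  obtain ⟨hy0, hk0⟩ := eq_zero_of_eq_pi_mul_add_sum_log α hα hαalg hy hk hcalg hid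
  refine ⟨two_mul_eq_of_cot_eq_zero ha haq ?_, hy0⟩
  have : (-(1 / 2) : ℝ) ≠ 0 := by norm_num
  simpa [this] using hk0

/-- **Engine at two points.** For `1 ≤ a < q`, `1 ≤ b < r` and real algebraic `u, v`: if
`ψ(a/q) − ψ(b/r) + u·log q + v·log r` is algebraic then `a/q = b/r` and the number vanishes
(the `π`-coefficient is `−½(cot(πa/q) − cot(πb/r))`). [cite: MurtySaradha2010, §3 (proof of Theorem 1, (8))] -/
theorem div_eq_div_of_isAlgebraic {a q b r : ℕ} (ha : 1 ≤ a) (haq : a < q) (hb : 1 ≤ b)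
    (hbr : b < r) {u v : ℝ} (hu : IsAlgebraic ℚ u) (hv : IsAlgebraic ℚ v)
    (hy : IsAlgebraic ℚ (digammaReal (a / q) - digammaReal (b / r) + u * Real.log q + v * Real.log r)) :
    (a : ℝ) / q = b / r ∧
      digammaReal (a / q) - digammaReal (b / r) + u * Real.log q + v * Real.log r = 0 := by
  have hq : 0 < q := by omega
  have hr : 0 < r := by omega
  have hqR : (0 : ℝ) < q := by exact_mod_cast hq
  have hrR : (0 : ℝ) < r := by exact_mod_cast hr
  let α : Option (Ico 1 q) ⊕ Option (Ico 1 r) → ℝ := fun s => s.elim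
    (fun o => o.elim (q : ℝ) fun n => 2 * Real.sin (Real.pi * n / q))
    (fun o => o.elim (r : ℝ) fun m => 2 * Real.sin (Real.pi * m / r))
  let c : Option (Ico 1 q) ⊕ Option (Ico 1 r) → ℝ := fun s => s.elim
    (fun o => o.elim (u - 1) fun n => Real.cos (2 * Real.pi * n * a / q))
    (fun o => o.elim (v + 1) fun m => -Real.cos (2 * Real.pi * m * b / r))
  have hα : ∀ s, 0 < α s := by
    rintro ((_ | ⟨n, hn⟩) | (_ | ⟨m, hm⟩))
    · exact hqR
    · exact two_mul_sin_pos (mem_Ico.1 hn).1 (mem_Ico.1 hn).2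
    · exact hrR
    · exact two_mul_sin_pos (mem_Ico.1 hm).1 (mem_Ico.1 hm).2
  have hαalg : ∀ s, IsAlgebraic ℚ (α s) := by
    rintro ((_ | ⟨n, hn⟩) | (_ | ⟨m, hm⟩))
    · exact isAlgebraic_nat q
    · exact (isAlgebraic_nat 2).mul (isAlgebraic_sin_rat_mul_pi n hq)
    · exact isAlgebraic_nat r
    · exact (isAlgebraic_nat 2).mul (isAlgebraic_sin_rat_mul_pi m hr)
  have hcalg : ∀ s, IsAlgebraic ℚ (c s) := by
    rintro ((_ | ⟨n, hn⟩) | (_ | ⟨m, hm⟩))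
    · exact hu.sub isAlgebraic_one
    · exact isAlgebraic_cos_two hq
    · exact hv.add isAlgebraic_one
    · exact (isAlgebraic_cos_two hr).neg
  set k : ℝ := -(1 / 2) * (Real.cos (Real.pi * a / q) / Real.sin (Real.pi * a / q) -
    Real.cos (Real.pi * b / r) / Real.sin (Real.pi * b / r)) with hkdef
  have hk : IsAlgebraic ℚ k :=
    (isAlgebraic_div isAlgebraic_one (isAlgebraic_nat 2)).neg.mul
      ((isAlgebraic_div (isAlgebraic_cos_rat_mul_pi a hq) (isAlgebraic_sin_rat_mul_pi a hq)).sub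
        (isAlgebraic_div (isAlgebraic_cos_rat_mul_pi b hr) (isAlgebraic_sin_rat_mul_pi b hr)))
  have hid : digammaReal (a / q) - digammaReal (b / r) + u * Real.log q + v * Real.log r =
      k * Real.pi + ∑ s, c s * Real.log (α s) := by
    rw [Fintype.sum_sum_type, Fintype.sum_option, Fintype.sum_option]
    change _ = _ + ((u - 1) * Real.log q +
      ∑ x : (Ico 1 q), Real.cos (2 * Real.pi * (x : ℕ) * a / q) * Real.log (2 * Real.sin (Real.pi * (x : ℕ) / q)) +
      ((v + 1) * Real.log r +
      ∑ x : (Ico 1 r), -Real.cos (2 * Real.pi * (x : ℕ) * b / r) * Real.log (2 * Real.sin (Real.pi * (x : ℕ) / r))))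
    rw [Finset.sum_coe_sort (Ico 1 q)
      (fun n => Real.cos (2 * Real.pi * n * a / q) * Real.log (2 * Real.sin (Real.pi * n / q))),
      Finset.sum_coe_sort (Ico 1 r)
      (fun m => -Real.cos (2 * Real.pi * m * b / r) * Real.log (2 * Real.sin (Real.pi * m / r)))]
    have hG₁ := digammaReal_add_eulerMascheroni_add_log ha haq
    have hG₂ := digammaReal_add_eulerMascheroni_add_log hb hbr
    have hneg : ∑ m ∈ Ico 1 r, -Real.cos (2 * Real.pi * m * b / r) * Real.log (2 * Real.sin (Real.pi * m / r)) =
        -∑ m ∈ Ico 1 r, Real.cos (2 * Real.pi * m * b / r) * Real.log (2 * Real.sin (Real.pi * m / r)) := by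
      rw [← Finset.sum_neg_distrib]
      exact Finset.sum_congr rfl fun m _ => by ring
    rw [hneg, hkdef]
    linear_combination hG₁ - hG₂
  obtain ⟨hy0, hk0⟩ := eq_zero_of_eq_pi_mul_add_sum_log α hα hαalg hy hk hcalg hid
  refine ⟨div_eq_div_of_cot_eq ha haq hb hbr ?_, hy0⟩
  have h2 : (-(1 / 2) : ℝ) ≠ 0 := by norm_num
  have := hk0
  rw [hkdef, mul_eq_zero] at this
  rcases this with h | h
  · exact absurd h h2
  · linarith

/-! ### `ψ` at `a/q` as a real number; `ψ(1/2)` -/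

/-- `ψ(a/q)` (Mathlib's complex digamma at the real point `a/q`, `1 ≤ a`, `0 < q`) is the real
number `digammaReal (a/q)`. [folklore] -/
private theorem digamma_div_natCast {a q : ℕ} (ha : 1 ≤ a) (hq : 0 < q) :
    Complex.digamma ((a : ℂ) / q) = ((digammaReal ((a : ℝ) / q) : ℝ) : ℂ) := by
  rw [← digamma_ofReal_eq_digammaReal (div_pos (by exact_mod_cast ha) (by exact_mod_cast hq))]
  push_cast
  rfl

/-- `ψ(1/2) + γ + log 4 = 0`, from Gauss's formula at `(a, q) = (1, 2)`
(`ψ(1/2) = −γ − 2 log 2`). [cite: MurtySaradha2010, §1 («γ(2,4) = γ/4»)] -/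
theorem digammaReal_half_add :
    digammaReal ((1 : ℕ) / (2 : ℕ)) + Real.eulerMascheroniConstant + Real.log 4 = 0 := by
  have h := digammaReal_add_eulerMascheroni_add_log (a := 1) (q := 2) le_rfl one_lt_two
  have hI : Ico 1 2 = {1} := by decide
  rw [hI, Finset.sum_singleton] at h
  have e1 : Real.pi * ((1 : ℕ) : ℝ) / ((2 : ℕ) : ℝ) = Real.pi / 2 := by push_cast; ring
  have e2 : 2 * Real.pi * ((1 : ℕ) : ℝ) * ((1 : ℕ) : ℝ) / ((2 : ℕ) : ℝ) = Real.pi := by push_cast; ring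
  rw [e1, e2, Real.cos_pi_div_two, Real.cos_pi, Real.sin_pi_div_two] at h
  have h4 : Real.log 4 = Real.log 2 + Real.log ((2 : ℕ) : ℝ) := by
    rw [show (4 : ℝ) = 2 * 2 by norm_num, Real.log_mul two_ne_zero two_ne_zero]; push_cast; ring
  rw [h4]
  simp only [zero_div, mul_zero, zero_mul, mul_one, neg_mul, one_mul, zero_add] at h
  linarith

/-! ### Theorem 4: the normalised constants `γ*(a,q) = qγ(a,q) = −(ψ(a/q) + log q)` are distinct -/

/-- **Theorem 4 (the `γ*(a,q)` among themselves).** For `1 ≤ a < q`, `1 ≤ b < r`: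
`−(ψ(a/q) + log q) = −(ψ(b/r) + log r)` only if `(a,q) = (b,r)` — indeed already when the
difference is ALGEBRAIC. [cite: MurtySaradha2010, Theorem 4] -/
theorem eq_of_isAlgebraic_eulerLehmerStar_sub {a q b r : ℕ} (ha : 1 ≤ a) (haq : a < q)
    (hb : 1 ≤ b) (hbr : b < r)
    (h : IsAlgebraic ℚ (-(Complex.digamma ((a : ℂ) / q) + Real.log q) -
      -(Complex.digamma ((b : ℂ) / r) + Real.log r))) : a = b ∧ q = r := by
  have hq : 0 < q := by omega
  have hr : 0 < r := by omega
  rw [digamma_div_natCast ha hq, digamma_div_natCast hb hr] at h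
  have h' : IsAlgebraic ℚ (((digammaReal (a / q) - digammaReal (b / r) + (1 : ℝ) * Real.log q +
      (-1 : ℝ) * Real.log r : ℝ) : ℂ)) := by
    convert h.neg using 1; push_cast; ring
  have hR := (isAlgebraic_algebraMap_iff (R := ℚ) (A := ℂ) Complex.ofReal_injective).mp h'
  obtain ⟨hdiv, h0⟩ := div_eq_div_of_isAlgebraic ha haq hb hbr isAlgebraic_one isAlgebraic_one.neg hR
  rw [hdiv] at h0
  have hlog : Real.log q = Real.log r := by linarith
  have hqr : (q : ℝ) = r := Real.log_injOn_pos (Set.mem_Ioi.2 (by exact_mod_cast hq))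
    (Set.mem_Ioi.2 (by exact_mod_cast hr)) hlog
  have hqr' : q = r := by exact_mod_cast hqr
  subst hqr'
  refine ⟨?_, rfl⟩
  have hqR : (q : ℝ) ≠ 0 := by exact_mod_cast hq.ne'
  have := hdiv
  field_simp at this
  exact_mod_cast this

/-- **Theorem 4 (distinctness of the `γ*(a,q)`).** The map `(a,q) ↦ γ*(a,q) = −(ψ(a/q) + log q)` is
injective on `{1 ≤ a < q}`. [cite: MurtySaradha2010, Theorem 4] -/
theorem eulerLehmerStar_injective {a q b r : ℕ} (ha : 1 ≤ a) (haq : a < q) (hb : 1 ≤ b)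
    (hbr : b < r)
    (h : -(Complex.digamma ((a : ℂ) / q) + Real.log q) = -(Complex.digamma ((b : ℂ) / r) + Real.log r)) :
    a = b ∧ q = r :=
  eq_of_isAlgebraic_eulerLehmerStar_sub ha haq hb hbr (by rw [h, sub_self]; exact isAlgebraic_zero)

/-- **Theorem 4 (`γ` against the `γ*(a,q)`), sharpened.** For `1 ≤ a < q`: if
`γ − γ*(a,q) = ψ(a/q) + γ + log q` is algebraic then `(a,q) = (2,4)`.
[cite: MurtySaradha2010, Theorem 4 and §3 (first case)] -/
theorem eq_two_four_of_isAlgebraic_digamma_add {a q : ℕ} (ha : 1 ≤ a) (haq : a < q)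
    (h : IsAlgebraic ℚ (Complex.digamma ((a : ℂ) / q) + Real.eulerMascheroniConstant + Real.log q)) :
    a = 2 ∧ q = 4 := by
  have hq : 0 < q := by omega
  rw [digamma_div_natCast ha hq] at h
  have h' : IsAlgebraic ℚ (((digammaReal (a / q) + Real.eulerMascheroniConstant + (1 : ℝ) * Real.log q : ℝ) : ℂ)) := by
    convert h using 1; push_cast; ring
  have hR := (isAlgebraic_algebraMap_iff (R := ℚ) (A := ℂ) Complex.ofReal_injective).mp h'
  obtain ⟨h2, h0⟩ := two_mul_eq_of_isAlgebraic ha haq isAlgebraic_one hR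
  have hhalf : (a : ℝ) / q = (1 : ℕ) / (2 : ℕ) := by
    rw [div_eq_div_iff (by exact_mod_cast hq.ne') (by norm_num)]
    exact_mod_cast (by omega : a * 2 = 1 * q)
  rw [hhalf, one_mul] at h0
  have h4 : Real.log q = Real.log 4 := by linarith [digammaReal_half_add]
  have hq4 : (q : ℝ) = 4 :=
    Real.log_injOn_pos (Set.mem_Ioi.2 (by exact_mod_cast hq)) (Set.mem_Ioi.2 (by norm_num)) h4
  have : q = 4 := by exact_mod_cast hq4
  omega

/-- **Theorem 4 (`γ` against the `γ*(a,q)`).** For `1 ≤ a < q`: `γ = γ*(a,q) = −(ψ(a/q) + log q)`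
if and only if `(a,q) = (2,4)`. [cite: MurtySaradha2010, Theorem 4] -/
theorem eulerLehmerStar_eq_eulerMascheroni_iff {a q : ℕ} (ha : 1 ≤ a) (haq : a < q) :
    -(Complex.digamma ((a : ℂ) / q) + Real.log q) = Real.eulerMascheroniConstant ↔ a = 2 ∧ q = 4 := by
  constructor
  · intro h
    refine eq_two_four_of_isAlgebraic_digamma_add ha haq ?_
    rw [show Complex.digamma ((a : ℂ) / q) + Real.eulerMascheroniConstant + Real.log q =
      Real.eulerMascheroniConstant - -(Complex.digamma ((a : ℂ) / q) + Real.log q) by ring, h, sub_self]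
    exact isAlgebraic_zero
  · rintro ⟨rfl, rfl⟩
    rw [digamma_div_natCast (by norm_num) (by norm_num)]
    have h := digammaReal_half_add
    have e : ((2 : ℕ) : ℝ) / ((4 : ℕ) : ℝ) = (1 : ℕ) / (2 : ℕ) := by push_cast; norm_num
    rw [e]
    have : digammaReal ((1 : ℕ) / (2 : ℕ)) = -Real.eulerMascheroniConstant - Real.log 4 := by linarith
    rw [this]; push_cast
    ring

end MurtySaradha2010

end Literature.NumberTheory.Transcendental
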